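import Literature.NumberTheory.DiophantineApproximation.NesterenkoCriterion
import HarnessLib

/-!
# Nesterenko's linear independence criterion — the original two-exponent form

Topic `Literature/NumberTheory/DiophantineApproximation`. Everything in this file is PROVED.

**Theorem** (Nesterenko 1985, Theorem 1, in the geometric normalisation `σ(n) = n log β`).
Let `θ₁, …, θ_s` be real numbers and `ℓ_n = p_{1,n} X₁ + ⋯ + p_{s,n} X_s` integer linear forms
with `limsup |p_{j,n}|^{1/n} ≤ β` (`β > 1`). Assume TWO-SIDED exponential brackets for the values:
`limsup |ℓ_n(θ)|^{1/n} ≤ α₂` and `liminf |ℓ_n(θ)|^{1/n} ≥ α₁` with `0 < α₁ ≤ α₂ < 1` — in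
Nesterenko's notation `τ₁ = -log α₁ / log β ≥ τ₂ = -log α₂ / log β > 0`. Then the `ℚ`-vector
space spanned by `θ₁, …, θ_s` has dimension at least
`(log β - log α₁)/(log β + log α₂ - log α₁) = (1 + τ₁)/(1 + τ₁ - τ₂)`
(`nesterenko_criterion_two_rates`). For `α₁ = α₂ = α` this is `1 - log α / log β`, the
exact-limit form of the sibling file (`nesterenko_criterion`, Fischler, Sém. Bourbaki 910,
Thm 2.8); the present form needs NO limit of `|ℓ_n(θ)|^{1/n}`, only brackets — which is what a
recurrence-based certificate (ratio induction) delivers.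

The hypotheses are rendered as: for every `β' > β`, `|p_{j,n}| ≤ β'^n` for all large `n`; for
every `a > α₂`, `|ℓ_n(θ)| < aⁿ` for all large `n`; for every `0 ≤ a < α₁`, `aⁿ < |ℓ_n(θ)|` for
all large `n`.

Proof: identical to the sibling file (reduction to a basis through `θ_{j₀} ≠ 0`, common
denominators, and the quantitative core `NesterenkoCriterion.core` of Chantanasiri 2012 with
`Q_n = M β'^n`, `A_n = 1/Λ_n`, `B_n = a₂^{-1}(a₂/a₁)^n`), now with `a₁ < α₁ ≤ α₂ < a₂`; letting
`a₁ → α₁`, `a₂ → α₂`, `β' → β` gives `-log α₂ ≤ (d - 1)(log β + log α₂ - log α₁)`.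

-- TODO(general form): Nesterenko's Theorem 1 allows any increasing `σ(n) → ∞` with
-- `σ(n+1)/σ(n) → 1` in place of `n log β`; only the geometric case is stated here.

## References

* Yu. V. Nesterenko, *On the linear independence of numbers*, Vestnik Moskov. Univ. Ser. I
  (1985) no. 1, 46–49; Moscow Univ. Math. Bull. 40 (1985) 69–74, Theorem 1. [Nesterenko1985]
* S. Fischler, *Irrationalité de valeurs de zêta*, Sém. Bourbaki 910, Astérisque 294 (2004),
  §2.2 (Théorème 2.8 and the remarks following it). [Fischler2004]
* A. Chantanasiri, Ann. Math. Blaise Pascal 19 (2012) 75–105, Thm 1.1. [Chantanasiri2012]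
-/

noncomputable section

open Filter Set Module
open scoped Topology

namespace Literature.NumberTheory.DiophantineApproximation

namespace NesterenkoCriterion

set_option maxHeartbeats 400000 in
/-- **Nesterenko's criterion, two-exponent form** (Nesterenko 1985, Theorem 1 with
`σ(n) = n log β`). Let `θ : ι → ℝ` and integer linear forms `ℓ_n = ∑_j p_{n,j} X_j` with
`|p_{n,j}| ≤ β'^n` for all large `n`, for every `β' > β` (`β > 1`); assume `|ℓ_n(θ)| < aⁿ`
eventually for every `a > α₂` and `aⁿ < |ℓ_n(θ)|` eventually for every `0 ≤ a < α₁`, where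
`0 < α₁ ≤ α₂ < 1`. Then `dim_ℚ (ℚθ₁ + ⋯ + ℚθ_s) ≥ (log β - log α₁)/(log β + log α₂ - log α₁)`,
i.e. `≥ (1 + τ₁)/(1 + τ₁ - τ₂)` with `τᵢ = -log αᵢ / log β`.
[cite: Nesterenko1985, Theorem 1 (geometric case σ(n) = n log β)] -/
theorem nesterenko_criterion_two_rates {ι : Type*} [Fintype ι] (θ : ι → ℝ) (p : ℕ → ι → ℤ)
    {α₁ α₂ β : ℝ} (hα₁ : 0 < α₁) (hα₁₂ : α₁ ≤ α₂) (hα₂1 : α₂ < 1) (hβ : 1 < β)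
    (hp : ∀ β' : ℝ, β < β' → ∀ᶠ n in atTop, ∀ j, |(p n j : ℝ)| ≤ β' ^ n)
    (hup : ∀ a : ℝ, α₂ < a → ∀ᶠ n in atTop, |∑ j, (p n j : ℝ) * θ j| < a ^ n)
    (hlow : ∀ a : ℝ, 0 ≤ a → a < α₁ → ∀ᶠ n in atTop, a ^ n < |∑ j, (p n j : ℝ) * θ j|) :
    (Real.log β - Real.log α₁) / (Real.log β + Real.log α₂ - Real.log α₁) ≤
      (finrank ℚ (Submodule.span ℚ (Set.range θ)) : ℝ) := by
  classical
  set ℓ : ℕ → ℝ := fun n => ∑ j, (p n j : ℝ) * θ j with hℓdef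
  have hα₂ : 0 < α₂ := hα₁.trans_le hα₁₂
  have hup' : ∀ a : ℝ, α₂ < a → ∀ᶠ n in atTop, |ℓ n| < a ^ n := hup
  have hlow' : ∀ a : ℝ, 0 ≤ a → a < α₁ → ∀ᶠ n in atTop, a ^ n < |ℓ n| := hlow
  -- some `θ j₀ ≠ 0`
  obtain ⟨j₀, hj₀⟩ : ∃ j₀, θ j₀ ≠ 0 := by
    by_contra h0
    push Not at h0
    obtain ⟨n, hn⟩ := (hlow' (α₁ / 2) (by positivity) (by linarith)).exists
    have : ℓ n = 0 := by
      simp only [hℓdef]; exact Finset.sum_eq_zero fun j _ => by rw [h0 j, mul_zero]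
    rw [this, abs_zero] at hn
    exact absurd hn (not_lt.mpr (pow_nonneg (by positivity) n))
  -- the span, a basis through `θ j₀`
  set V : Submodule ℚ ℝ := Submodule.span ℚ (Set.range θ) with hV
  have hθV : ∀ j, θ j ∈ V := fun j => Submodule.subset_span ⟨j, rfl⟩
  haveI : Module.Finite ℚ V := Module.Finite.span_of_finite ℚ (Set.finite_range θ)
  set v₀ : V := ⟨θ j₀, hθV j₀⟩ with hv₀def
  have hv₀ : v₀ ≠ 0 := by
    intro h
    apply hj₀
    have h' := congrArg Subtype.val h
    exact h'
  have hli : LinearIndepOn ℚ id ({v₀} : Set V) := LinearIndepOn.singleton hv₀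
  set I : Set V := hli.extend (Set.subset_univ _) with hI
  let b : Basis I ℚ V := Basis.extend hli
  haveI : Fintype I := FiniteDimensional.fintypeBasisIndex b
  have hv₀I : v₀ ∈ I := Basis.subset_extend hli (Set.mem_singleton v₀)
  set i₀ : I := ⟨v₀, hv₀I⟩ with hi₀
  have hbi₀ : ((b i₀ : V) : ℝ) = θ j₀ := by
    rw [Basis.extend_apply_self]
  have hcard : Fintype.card I = finrank ℚ V := (finrank_eq_card_basis b).symm
  -- coordinates of the `θ j` and a common denominator
  set c : ι × I → ℚ := fun ji => b.repr ⟨θ ji.1, hθV ji.1⟩ ji.2 with hc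
  have hrepr : ∀ j, θ j = ∑ i, (c (j, i) : ℝ) * ((b i : V) : ℝ) := by
    intro j
    have h1 := b.sum_repr ⟨θ j, hθV j⟩
    have h2 := congrArg Subtype.val h1
    simp only [Submodule.coe_sum, Submodule.coe_smul, Rat.smul_def] at h2
    exact h2.symm
  obtain ⟨D, hD, m, hm⟩ := exists_common_den c
  have hDθ : ∀ j, (D : ℝ) * θ j = ∑ i, (m (j, i) : ℝ) * ((b i : V) : ℝ) := by
    intro j
    rw [hrepr j, Finset.mul_sum]
    refine Finset.sum_congr rfl fun i _ => ?_
    rw [hm]; ring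
  -- the new point `ξ` and forms `P`
  set ξ : I → ℝ := fun i => ((b i : V) : ℝ) / θ j₀ with hξdef
  have hξ : ξ i₀ = 1 := by simp only [hξdef]; rw [hbi₀, div_self hj₀]
  set P : ℕ → I → ℤ := fun n i => ∑ j, p n j * m (j, i) with hP
  set C : ℝ := D / θ j₀ with hC
  have hC0 : C ≠ 0 := div_ne_zero (by exact_mod_cast hD.ne') hj₀
  have hPξ : ∀ n, ∑ i, (P n i : ℝ) * ξ i = C * ℓ n := by
    intro n
    simp only [hP, hξdef, hℓdef, hC]
    push_cast
    have e1 : ∀ i, (∑ j, (p n j : ℝ) * (m (j, i) : ℝ)) * (((b i : V) : ℝ) / θ j₀) =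
        ∑ j, (p n j : ℝ) * ((m (j, i) : ℝ) * ((b i : V) : ℝ)) / θ j₀ := by
      intro i
      rw [Finset.sum_mul]
      refine Finset.sum_congr rfl fun j _ => ?_
      ring
    rw [Finset.sum_congr rfl (fun i _ => e1 i), Finset.sum_comm]
    simp_rw [← Finset.sum_div, ← Finset.mul_sum, ← hDθ]
    rw [Finset.mul_sum, Finset.sum_div]
    refine Finset.sum_congr rfl fun j _ => ?_
    ring
  -- size of the new coefficients
  set M : ℝ := ∑ ji, |(m ji : ℝ)| + 1 with hM
  have hM0 : 0 < M := by
    have : 0 ≤ ∑ ji, |(m ji : ℝ)| := Finset.sum_nonneg fun _ _ => abs_nonneg _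
    linarith
  have hPbound : ∀ n (β' : ℝ), 0 ≤ β' → (∀ j, |(p n j : ℝ)| ≤ β' ^ n) →
      ∑ i, |(P n i : ℝ)| ≤ M * β' ^ n := by
    intro n β' hβ' hpn
    simp only [hP]
    push_cast
    calc ∑ i, |∑ j, (p n j : ℝ) * (m (j, i) : ℝ)|
        ≤ ∑ i, ∑ j, |(p n j : ℝ)| * |(m (j, i) : ℝ)| := by
          refine Finset.sum_le_sum fun i _ => (Finset.abs_sum_le_sum_abs _ _).trans ?_
          refine Finset.sum_le_sum fun j _ => ?_
          rw [abs_mul]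
      _ ≤ ∑ i, ∑ j, β' ^ n * |(m (j, i) : ℝ)| := by
          refine Finset.sum_le_sum fun i _ => Finset.sum_le_sum fun j _ => ?_
          exact mul_le_mul_of_nonneg_right (hpn j) (abs_nonneg _)
      _ = β' ^ n * ∑ ji, |(m ji : ℝ)| := by
          rw [Fintype.sum_prod_type, Finset.mul_sum]
          rw [Finset.sum_comm]
          refine Finset.sum_congr rfl fun j _ => ?_
          rw [Finset.mul_sum]
      _ ≤ M * β' ^ n := by
          rw [mul_comm]
          exact mul_le_mul_of_nonneg_right (by linarith) (pow_nonneg hβ' n)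
  -- the key inequality, for every small `ε > 0`
  set r : ℕ := Fintype.card I - 1 with hr
  have hkey : ∀ ε : ℝ, 0 < ε → ε < -Real.log α₂ →
      -Real.log α₂ ≤ r * (Real.log β + Real.log α₂ - Real.log α₁) + (3 * r + 1) * ε := by
    intro ε hε hεα
    set a₁ : ℝ := α₁ * Real.exp (-ε) with ha₁
    set a₂ : ℝ := α₂ * Real.exp ε with ha₂
    set β' : ℝ := β * Real.exp ε with hβ'
    have hε1 : 1 < Real.exp ε := Real.one_lt_exp_iff.mpr hε
    have hε2 : Real.exp (-ε) < 1 := Real.exp_lt_one_iff.mpr (by linarith)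
    have ha₁0 : 0 < a₁ := by positivity
    have ha₁α : a₁ < α₁ := by
      have : α₁ * Real.exp (-ε) < α₁ * 1 := mul_lt_mul_of_pos_left hε2 hα₁
      simpa [ha₁] using this
    have hαa₂ : α₂ < a₂ := by
      have : α₂ * 1 < α₂ * Real.exp ε := mul_lt_mul_of_pos_left hε1 hα₂
      simpa [ha₂] using this
    have ha₂0 : 0 < a₂ := hα₂.trans hαa₂
    have ha₁a₂ : a₁ ≤ a₂ := ha₁α.le.trans (hα₁₂.trans hαa₂.le)
    have ha₂1 : a₂ < 1 := by
      rw [ha₂]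
      have : Real.exp ε < Real.exp (-Real.log α₂) := Real.exp_lt_exp.mpr hεα
      rw [Real.exp_neg, Real.exp_log hα₂] at this
      calc α₂ * Real.exp ε < α₂ * α₂⁻¹ := mul_lt_mul_of_pos_left this hα₂
        _ = 1 := mul_inv_cancel₀ hα₂.ne'
    have hββ' : β < β' := by
      have : β * 1 < β * Real.exp ε := mul_lt_mul_of_pos_left hε1 (by linarith)
      simpa [hβ'] using this
    have hβ'1 : 1 < β' := hβ.trans hββ'
    -- eventual bounds, and a threshold `N`
    obtain ⟨N, hN⟩ := eventually_atTop.mp ((hlow' a₁ ha₁0.le ha₁α).and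
      ((hup' a₂ hαa₂).and (hp β' hββ')))
    -- data for the core theorem
    set Q : ℕ → ℝ := fun n => M * β' ^ n with hQ
    set Λ' : ℕ → ℝ := fun n => |∑ i, (P n i : ℝ) * ξ i| with hΛ'
    have hΛ'eq : ∀ n, Λ' n = |C| * |ℓ n| := by
      intro n; simp only [hΛ']; rw [hPξ, abs_mul]
    set A : ℕ → ℝ := fun n => 1 / Λ' n with hA
    set B : ℕ → ℝ := fun n => a₂⁻¹ * (a₂ / a₁) ^ n with hB
    have hCpos : 0 < |C| := abs_pos.mpr hC0
    have hΛ'pos : ∀ n, N ≤ n → 0 < Λ' n := by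
      intro n hn
      rw [hΛ'eq]
      have := (hN n hn).1
      exact mul_pos hCpos ((pow_pos ha₁0 n).trans this)
    have hΛ'le : ∀ n, N ≤ n → Λ' n < |C| * a₂ ^ n := by
      intro n hn
      rw [hΛ'eq]
      exact mul_lt_mul_of_pos_left (hN n hn).2.1 hCpos
    -- apply the core with `n₀ = N + 1`
    have hcore := core (ι := I) i₀ ξ hξ P Q A B (N + 1)
      (fun n hn => hPbound n β' (by linarith) (hN n (by omega)).2.2)
      (fun n hn => hΛ'pos n (by omega))
      (fun n hn => by
        simp only [hA]; rw [one_div_one_div])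
      (fun n hn => by simp only [hA]; exact one_div_pos.mpr (hΛ'pos n (by omega)))
      (fun n hn => by
        -- `Λ'(n-1) ≤ B n Λ' n`
        change Λ' (n - 1) ≤ B n * Λ' n
        have h1 : Λ' (n - 1) < |C| * a₂ ^ (n - 1) := hΛ'le (n - 1) (by omega)
        have h2 : |C| * a₁ ^ n < Λ' n := by
          rw [hΛ'eq]; exact mul_lt_mul_of_pos_left (hN n (by omega)).1 hCpos
        have h3 : B n * (|C| * a₁ ^ n) = |C| * a₂ ^ (n - 1) := by
          simp only [hB]
          obtain ⟨k, rfl⟩ : ∃ k, n = k + 1 := ⟨n - 1, by omega⟩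
          rw [Nat.add_sub_cancel, div_pow, pow_succ a₂]
          field_simp
        have hB0 : 0 ≤ B n := by simp only [hB]; positivity
        nlinarith)
      (fun n hn => by
        simp only [hB, hQ]
        have h1 : a₂⁻¹ * (a₂ / a₁) ^ (n + 1) * (M * β' ^ (n + 1)) =
            a₂⁻¹ * (a₂ / a₁) ^ n * (M * β' ^ n) * (a₂ / a₁ * β') := by ring
        rw [h1]
        refine le_mul_of_one_le_right (by positivity) ?_
        have : 1 ≤ a₂ / a₁ := (one_le_div ha₁0).mpr ha₁a₂
        nlinarith)
      (by
        -- `A n = 1 / Λ' n → ∞`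
        have ht : Tendsto Λ' atTop (𝓝[>] 0) := by
          rw [tendsto_nhdsWithin_iff]
          refine ⟨?_, ?_⟩
          · have hg : Tendsto (fun n : ℕ => |C| * a₂ ^ n) atTop (𝓝 0) := by
              simpa using (tendsto_pow_atTop_nhds_zero_of_lt_one ha₂0.le ha₂1).const_mul |C|
            refine squeeze_zero' (Eventually.of_forall fun n => abs_nonneg _) ?_ hg
            filter_upwards [eventually_ge_atTop N] with n hn using (hΛ'le n hn).le
          · filter_upwards [eventually_ge_atTop N] with n hn using hΛ'pos n hn
        have := ht.inv_tendsto_nhdsGT_zero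
        refine this.congr fun n => ?_
        simp [hA])
    -- read off the exponential inequality
    have hev : ∀ᶠ n : ℕ in atTop, |C|⁻¹ * a₂⁻¹ ^ n ≤
        (4 * (2 * a₂⁻¹ * M) ^ r) * ((a₂ / a₁ * β') ^ r) ^ n := by
      filter_upwards [hcore, eventually_ge_atTop N] with n hn hnN
      have h1 : |C|⁻¹ * a₂⁻¹ ^ n < A n := by
        simp only [hA]
        rw [lt_one_div (by positivity) (hΛ'pos n hnN), one_div, mul_inv, inv_inv, ← inv_pow,
          inv_inv]
        exact hΛ'le n hnN
      have h2 : (4 : ℝ) * (2 * B n * Q n) ^ (Fintype.card I - 1) =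
          (4 * (2 * a₂⁻¹ * M) ^ r) * ((a₂ / a₁ * β') ^ r) ^ n := by
        rw [← hr]; simp only [hB, hQ]
        rw [← pow_mul, mul_comm r n, pow_mul]
        ring
      rw [← h2]
      exact (h1.trans hn).le
    have hle := le_of_eventually_mul_pow_le (inv_pos.mpr hCpos) (by positivity) hev
    -- take logarithms
    have hlog := Real.log_le_log (inv_pos.mpr ha₂0) hle
    have e1 : Real.log a₂⁻¹ = -(Real.log α₂ + ε) := by
      rw [Real.log_inv, ha₂, Real.log_mul hα₂.ne' (Real.exp_pos ε).ne', Real.log_exp]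
    have e2 : Real.log ((a₂ / a₁ * β') ^ r) =
        r * (Real.log α₂ - Real.log α₁ + 3 * ε + Real.log β) := by
      rw [Real.log_pow, Real.log_mul (div_pos ha₂0 ha₁0).ne' (zero_lt_one.trans hβ'1).ne',
        Real.log_div ha₂0.ne' ha₁0.ne', ha₂, ha₁, hβ', Real.log_mul hα₂.ne' (Real.exp_pos _).ne',
        Real.log_mul hα₁.ne' (Real.exp_pos _).ne', Real.log_mul (by linarith) (Real.exp_pos _).ne',
        Real.log_exp, Real.log_exp]
      ring
    rw [e1, e2] at hlog
    nlinarith [hlog]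
  -- conclude: `-log α₂ ≤ r (log β + log α₂ - log α₁)`
  have hlogβ : 0 < Real.log β := Real.log_pos hβ
  have hlogα : 0 < -Real.log α₂ := by
    have := Real.log_neg hα₂ hα₂1; linarith
  have hlog12 : Real.log α₁ ≤ Real.log α₂ := Real.log_le_log hα₁ hα₁₂
  set Dn : ℝ := Real.log β + Real.log α₂ - Real.log α₁ with hDn
  have hDn0 : 0 < Dn := by rw [hDn]; linarith
  have hmain : -Real.log α₂ ≤ r * Dn := by
    by_contra hlt
    push Not at hlt
    set g : ℝ := -Real.log α₂ - r * Dn with hg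
    have hgpos : 0 < g := by linarith
    set ε : ℝ := min (-Real.log α₂ / 2) (g / (2 * (3 * r + 1))) with hεdef
    have hr0 : (0 : ℝ) < 3 * r + 1 := by positivity
    have hε : 0 < ε := lt_min (by linarith) (by positivity)
    have hε1 : ε < -Real.log α₂ := (min_le_left _ _).trans_lt (by linarith)
    have hε2 : (3 * r + 1) * ε ≤ g / 2 := by
      have : ε ≤ g / (2 * (3 * r + 1)) := min_le_right _ _
      rw [le_div_iff₀ (by positivity)] at this
      linarith
    have := hkey ε hε hε1
    rw [hDn] at hg
    linarith
  -- `finrank = r + 1`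
  have hcardpos : 0 < Fintype.card I := Fintype.card_pos_iff.mpr ⟨i₀⟩
  have hfr : (finrank ℚ V : ℝ) = r + 1 := by
    rw [← hcard, hr]
    norm_cast
    omega
  rw [hfr]
  have h1 : -Real.log α₂ / Dn ≤ r := by
    rw [div_le_iff₀ hDn0]; exact hmain
  have h2 : (Real.log β - Real.log α₁) / Dn = -Real.log α₂ / Dn + 1 := by
    field_simp
    rw [hDn]; ring
  rw [h2]
  linarith

end NesterenkoCriterion

end Literature.NumberTheory.DiophantineApproximation
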